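import Literature.NumberTheory.LFunctions.Zhang2022.DetectorShiftLeadingCoeff
import Literature.NumberTheory.LFunctions.Zhang2022.DetectorShiftGramSign
import Literature.NumberTheory.LFunctions.Zhang2022.DetectorShiftBulkSymbol

/-!
# Zhang (2022), programme F-S3 (cell landau-siegel §E, E-102 head 2, piece P6): the CLOSED FORMS of the shift-triple
# recipe — the trigonometric functional `Φ_θ(b)`, `c₀(b) = 2Φ_{1/2}(b)/D⁺(b)`, the predicted Gram determinant
# `64Φ_{1/2}²Φ₁/(b₀b₁b₂D⁺)`, the DOUBLING identity `Φ₁(b) = Φ_{1/2}(2b)/4`, and their SIGNS on the sign-admissible set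

Y. Zhang, *Discrete mean estimates and the Landau–Siegel zero*, arXiv:2211.02515v1 [Zhang2022LandauSiegel] —
an unrefereed manuscript under adjudication. **WHAT THIS IS NOT: not a claim about Theorems 1–2 of
arXiv:2211.02515, about Landau–Siegel zeros, or about Parity; nothing here asserts any claim of the manuscript.
The programme SEARCHES and TYPES; no claim about Landau–Siegel zeros, Theorems 1–2 of arXiv:2211.02515 or a
repaired Margin232 until a kernel theorem says so.** Seat ls-barrier-p2 g3 (pen, booked 2026-08-27T01:33:19Z);
reader ls-barrier-num g2 (author of the cell memo barrier/num/H-CLOSED-FORM.md f80d823e4b71f884, whose §0–§1 and §9(1)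
this file types).

## What is here (all theorems; elementary real trigonometry and field algebra; no numerics, no facts)

For a real shift triple `b = (b₀, b₁, b₂)` (tree indexing `Fin 3`; the memo writes `(b₁,b₂,b₃)`):

* `Det.phiTheta θ b := b₁(b₂−b₀)·sin(θπb₀)·sin(θπ(b₂−b₁)) − b₀(b₂−b₁)·sin(θπb₁)·sin(θπ(b₂−b₀))` (memo `Φ_θ`, two-term
  form); `phiTheta_eq_three_term` (the symmetric three-term form of the memo, a pure `sin` identity);
  `phiTheta_one_eq_phiHalf_double` — **the doubling identity `Φ₁(b) = Φ_{1/2}(2b)/4`** (memo §9 (1)).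
* `Det.dPlus b := (b₁−b₀)(b₂−b₀)(b₂−b₁)` (`D⁺`), `Det.c0Closed b := 2Φ_{1/2}(b)/D⁺(b)` and
  **`re_sum_shiftW_eq_c0Closed`: `Re Σ_j W_j(b) = c0Closed b`** for pairwise-distinct `b` — Id-1 of the memo in its
  `Φ`-form (the `sin`-form is the tree's `Det.re_sum_shiftW_eq`, p478269).
* `Det.detGramClosed b := 64·Φ_{1/2}(b)²·Φ₁(b)/(b₀b₁b₂·D⁺(b))` — the memo's closed form (Id-2) for the determinant of the
  2×2 Gram matrix `C(b)` of the one-sided polar main-term form on the AFE plane; `detGramClosed_eq_sinc_form` (the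
  memo's §0 item 2: `(16/b₂)·c₀²·(b₁−b₀)(b₂−b₀)²(b₂−b₁)²·[Q(b₀)Q(b₂−b₁) − Q(b₁)Q(b₂−b₀)]`, `Q(x) = sin(πx)/x`) and
  **`detGramClosed_eq_doubling`: `detGramClosed b = 16·c₀(b)²·c₀(2b)·D⁺(b)²/(b₀b₁b₂)`** (memo §9 (1): the sign of
  the determinant is the sign of the leading coefficient at the DOUBLED triple).
* SIGNS on the sign-admissible set (`Det.SignAdmissible`, p459592): `c0Closed_pos` (= `Det.re_sum_shiftW_pos`, (I1));
  **`detGramClosed_pos`** off the three edges through the lattice corner and `detGramClosed_nonneg` on the closed gap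
  cell (from (I1) and the tree's `Det.gramSign_pos/_nonneg`, p481730 = (I2)); controls `c0Closed_std = 4`,
  `detGramClosed_std = 0` at the printed `(1,2,3)`, and `c0Closed_bStar = 8/3`, `detGramClosed_bStar = 4096/15` at
  `b⋆ = (½, 2, 5/2)` (the memo's check values).

* **v2 (Part 6–7, [K1] of the DOUBLING plan of record 2026-08-27T01:45:23Z):** the shared vocabulary `Det.bulkFormOn`
  (`T_b` on an interval), `Det.tailPrim` (`S_g = ∫_y^1 g`), atoms `Det.atomA0/atomAb/atomAN` (= `ddM0/ddMb/ddMn` for a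
  distinct triple) and Zhang's free-end boundary form `Det.freeEndForm` (shapes of ls-barrier-num's sketch), and THE
  S-VARIABLE CLOSED FORM `formDet_shiftRecipe_eq_bulk_add_freeEnd`:
  `(π/2)·FormDet(shiftRecipe b)(g) = Re A₀(b)·T_b^{[0,1]}(S_g) + freeEndForm b (S_g(0), S_g′(0))` for one-sided kinked `g`
  (from `Det.formDetDD_eq_reIm`, p482386, by the `S ↔ g` dictionary `S′ = −g`, `S″ = −g′`).

**What is NOT here (honest).** Id-2 ITSELF — that `detGramClosed b` equals the determinant of the actual Gram matrix
`C(b)` of `Det.FormDet (Det.shiftRecipe b)` on the AFE plane `E_b` — is an exact two-lineage computer-algebra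
identity (barrier/num CERTS.tsv E-CERT-005; kits j262562, j263725) and NOT a kernel theorem: the tree has no
`Det.afeGram` yet (piece P5 `formDetPSD_iff_shadow` of PARSEVAL-C2 §4). This file supplies the right-hand side as a
kernel object with all its algebra and signs, so that P5 has one equation to prove and the index/continuity argument
(H-CLOSED-FORM §3; PARSEVAL-C2 §3) can quote `detGramClosed_pos` for «`det C ≠ 0` off the edges».

References: Y. Zhang, arXiv:2211.02515v1 (2022), §2 Lemma 2.3, (2.13); proof of Prop 7.1, (7.19)–(7.21) [p. 44];
§8 (8.11)–(8.23). [cite: Zhang2022LandauSiegel, §2 Lemma 2.3; Prop 7.1 (7.19)–(7.21); §8 (8.11)–(8.23)]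
-/

noncomputable section

open Real

namespace Literature.NumberTheory.LFunctions.Zhang2022

namespace Det

/-! ### Part 1 — the functional `Φ_θ(b)` and its three forms -/

/-- **`Φ_θ(b)`** (memo H-CLOSED-FORM §0/§1, two-term form):
`b₁(b₂−b₀)·sin(θπb₀)·sin(θπ(b₂−b₁)) − b₀(b₂−b₁)·sin(θπb₁)·sin(θπ(b₂−b₀))`.
[cite: Zhang2022LandauSiegel, proof of Prop 7.1 (7.19)–(7.21)] -/
def phiTheta (θ : ℝ) (b : Fin 3 → ℝ) : ℝ :=
  b 1 * (b 2 - b 0) * Real.sin (θ * π * b 0) * Real.sin (θ * π * (b 2 - b 1))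
    - b 0 * (b 2 - b 1) * Real.sin (θ * π * b 1) * Real.sin (θ * π * (b 2 - b 0))

/-- The `sin` identity behind the two forms of `Φ_θ`: `sin A·sin(C−B) − sin B·sin(C−A) + sin C·sin(B−A) = 0`.
[folklore] -/
private theorem sin_mul_sin_sub_cycl (A B C : ℝ) :
    Real.sin A * Real.sin (C - B) - Real.sin B * Real.sin (C - A) + Real.sin C * Real.sin (B - A) = 0 := by
  simp only [Real.sin_sub]
  ring

/-- **Three-term form** (memo §1, first line): `Φ_θ(b) = b₁b₂·sin(θπb₀)sin(θπ(b₂−b₁)) − b₀b₂·sin(θπb₁)sin(θπ(b₂−b₀))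
+ b₀b₁·sin(θπb₂)sin(θπ(b₁−b₀))`. [cite: Zhang2022LandauSiegel, proof of Prop 7.1 (7.19)–(7.21)] -/
theorem phiTheta_eq_three_term (θ : ℝ) (b : Fin 3 → ℝ) :
    phiTheta θ b =
      b 1 * b 2 * Real.sin (θ * π * b 0) * Real.sin (θ * π * (b 2 - b 1))
        - b 0 * b 2 * Real.sin (θ * π * b 1) * Real.sin (θ * π * (b 2 - b 0))
        + b 0 * b 1 * Real.sin (θ * π * b 2) * Real.sin (θ * π * (b 1 - b 0)) := by
  have h := sin_mul_sin_sub_cycl (θ * π * b 0) (θ * π * b 1) (θ * π * b 2)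
  have e1 : θ * π * (b 2 - b 1) = θ * π * b 2 - θ * π * b 1 := by ring
  have e2 : θ * π * (b 2 - b 0) = θ * π * b 2 - θ * π * b 0 := by ring
  have e3 : θ * π * (b 1 - b 0) = θ * π * b 1 - θ * π * b 0 := by ring
  unfold phiTheta
  rw [e1, e2, e3]
  have key : b 0 * b 1 * (Real.sin (θ * π * b 0) * Real.sin (θ * π * b 2 - θ * π * b 1)
      - Real.sin (θ * π * b 1) * Real.sin (θ * π * b 2 - θ * π * b 0)
      + Real.sin (θ * π * b 2) * Real.sin (θ * π * b 1 - θ * π * b 0)) = 0 := by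
    rw [h, mul_zero]
  linear_combination (-1 : ℝ) * key

/-- **`sinc` form** (memo §1, third line): for `θ ≠ 0` and non-degenerate `b`,
`Φ_θ(b) = b₀b₁(b₂−b₁)(b₂−b₀)·θ²π²·[S(b₀)S(b₂−b₁) − S(b₁)S(b₂−b₀)]`, `S(x) = sin(θπx)/(θπx)`.
[cite: Zhang2022LandauSiegel, proof of Prop 7.1 (7.19)–(7.21)] -/
theorem phiTheta_eq_sinc_form {θ : ℝ} (hθ : θ ≠ 0) {b : Fin 3 → ℝ} (h0 : b 0 ≠ 0) (h1 : b 1 ≠ 0)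
    (h21 : b 2 - b 1 ≠ 0) (h20 : b 2 - b 0 ≠ 0) :
    phiTheta θ b =
      b 0 * b 1 * (b 2 - b 1) * (b 2 - b 0) * (θ ^ 2 * π ^ 2) *
        (Real.sin (θ * π * b 0) / (θ * π * b 0) * (Real.sin (θ * π * (b 2 - b 1)) / (θ * π * (b 2 - b 1)))
          - Real.sin (θ * π * b 1) / (θ * π * b 1) * (Real.sin (θ * π * (b 2 - b 0)) / (θ * π * (b 2 - b 0)))) := by
  have hπ : (π : ℝ) ≠ 0 := Real.pi_ne_zero
  unfold phiTheta
  field_simp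

/-- **DOUBLING identity** (memo §9 (1)): `Φ₁(b) = Φ_{1/2}(2b)/4`. [cite: Zhang2022LandauSiegel, proof of Prop 7.1 (7.19)–(7.21)] -/
theorem phiTheta_one_eq_phiHalf_double (b : Fin 3 → ℝ) :
    phiTheta 1 b = phiTheta (1 / 2) (fun j => 2 * b j) / 4 := by
  unfold phiTheta
  have e0 : 1 / 2 * π * (2 * b 0) = 1 * π * b 0 := by ring
  have e1 : 1 / 2 * π * (2 * b 1) = 1 * π * b 1 := by ring
  have e2 : 1 / 2 * π * (2 * b 2 - 2 * b 1) = 1 * π * (b 2 - b 1) := by ring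
  have e3 : 1 / 2 * π * (2 * b 2 - 2 * b 0) = 1 * π * (b 2 - b 0) := by ring
  rw [e0, e1, e2, e3]
  ring

/-! ### Part 2 — `D⁺`, the closed form of `c₀`, and Id-1 in `Φ`-form -/

/-- `D⁺(b) = (b₁−b₀)(b₂−b₀)(b₂−b₁)` (positive for a sorted triple). [cite: Zhang2022LandauSiegel, proof of Prop 7.1 (7.19)–(7.21)] -/
def dPlus (b : Fin 3 → ℝ) : ℝ := (b 1 - b 0) * (b 2 - b 0) * (b 2 - b 1)

/-- `D⁺ > 0` for `b₀ < b₁ < b₂`. [cite: Zhang2022LandauSiegel, proof of Prop 7.1 (7.19)–(7.21)] -/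
theorem dPlus_pos {b : Fin 3 → ℝ} (h01 : b 0 < b 1) (h12 : b 1 < b 2) : 0 < dPlus b := by
  unfold dPlus
  exact mul_pos (mul_pos (sub_pos.2 h01) (sub_pos.2 (h01.trans h12))) (sub_pos.2 h12)

/-- `D⁺(2b) = 8·D⁺(b)`. [cite: Zhang2022LandauSiegel, proof of Prop 7.1 (7.19)–(7.21)] -/
theorem dPlus_double (b : Fin 3 → ℝ) : dPlus (fun j => 2 * b j) = 8 * dPlus b := by
  unfold dPlus; ring

/-- **The closed form of the leading coefficient**: `c₀(b) := 2Φ_{1/2}(b)/D⁺(b)` (memo §0 item 1).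
[cite: Zhang2022LandauSiegel, proof of Prop 7.1 (7.19)–(7.21)] -/
def c0Closed (b : Fin 3 → ℝ) : ℝ := 2 * phiTheta (1 / 2) b / dPlus b

/-- **Id-1 in `Φ`-form: `Re Σ_j W_j(b) = 2Φ_{1/2}(b)/D⁺(b)`** for a pairwise-distinct triple (from the tree's
`Det.re_sum_shiftW_eq`, p478269). [cite: Zhang2022LandauSiegel, proof of Prop 7.1 (7.19)–(7.21)] -/
theorem re_sum_shiftW_eq_c0Closed (b : Fin 3 → ℝ) (h01 : b 0 ≠ b 1) (h02 : b 0 ≠ b 2) (h12 : b 1 ≠ b 2) :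
    (∑ j : Fin 3, shiftW b j).re = c0Closed b := by
  rw [re_sum_shiftW_eq b h01 h02 h12]
  unfold c0Closed phiTheta dPlus
  have d10 : b 1 - b 0 ≠ 0 := sub_ne_zero.2 (Ne.symm h01)
  have d21 : b 2 - b 1 ≠ 0 := sub_ne_zero.2 (Ne.symm h12)
  have d20 : b 2 - b 0 ≠ 0 := sub_ne_zero.2 (Ne.symm h02)
  have e0 : π / 2 * b 0 = 1 / 2 * π * b 0 := by ring
  have e1 : π / 2 * b 1 = 1 / 2 * π * b 1 := by ring
  have e2 : π / 2 * (b 2 - b 1) = 1 / 2 * π * (b 2 - b 1) := by ring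
  have e3 : π / 2 * (b 2 - b 0) = 1 / 2 * π * (b 2 - b 0) := by ring
  rw [e0, e1, e2, e3]
  field_simp

/-- **(I1) in closed form: `c0Closed b > 0` for every sign-admissible `b`** (the tree's `Det.re_sum_shiftW_pos`).
[cite: Zhang2022LandauSiegel, §2 Lemma 2.3; proof of Prop 7.1 (7.19)–(7.21)] -/
theorem c0Closed_pos {b : Fin 3 → ℝ} (hb : SignAdmissible b) : 0 < c0Closed b := by
  have h01 : b 0 < b 1 := hb.2.1
  have h12 : b 1 < b 2 := hb.2.2.1
  rw [← re_sum_shiftW_eq_c0Closed b h01.ne (h01.trans h12).ne h12.ne]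
  exact re_sum_shiftW_pos hb

/-- `Φ_{1/2}(b) > 0` for every sign-admissible `b` (`= c₀·D⁺/2`). [cite: Zhang2022LandauSiegel, §2 Lemma 2.3; proof of Prop 7.1 (7.19)–(7.21)] -/
theorem phiHalf_pos {b : Fin 3 → ℝ} (hb : SignAdmissible b) : 0 < phiTheta (1 / 2) b := by
  have hc := c0Closed_pos hb
  obtain ⟨_, h01, h12, _, _⟩ := hb
  have hD := dPlus_pos h01 h12
  unfold c0Closed at hc
  have : 0 < 2 * phiTheta (1 / 2) b := by
    by_contra h
    have h' : 2 * phiTheta (1 / 2) b / dPlus b ≤ 0 := div_nonpos_of_nonpos_of_nonneg (not_lt.mp h) hD.le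
    linarith
  linarith

/-! ### Part 3 — the predicted Gram determinant: closed form, `sinc` form, doubling form -/

/-- **The closed form (Id-2, right-hand side) of `det C(b)`**, `C(b)` the 2×2 Gram matrix of the one-sided polar
main-term form `Det.FormDet (Det.shiftRecipe b)` on the AFE plane: `64·Φ_{1/2}(b)²·Φ₁(b)/(b₀b₁b₂·D⁺(b))`
(memo §0 item 2, second form). That this IS `det C(b)` is the exact CAS identity E-CERT-005 (two lineages), not a
kernel theorem (no `Det.afeGram` in tree yet). [cite: Zhang2022LandauSiegel, §8 (8.11)–(8.23); proof of Prop 7.1 (7.19)–(7.21)] -/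
def detGramClosed (b : Fin 3 → ℝ) : ℝ :=
  64 * phiTheta (1 / 2) b ^ 2 * phiTheta 1 b / (b 0 * b 1 * b 2 * dPlus b)

/-- **`sinc` form of the predicted determinant** (memo §0 item 2, first form):
`detGramClosed b = (16/b₂)·c₀(b)²·(b₁−b₀)(b₂−b₀)²(b₂−b₁)²·[Q(b₀)Q(b₂−b₁) − Q(b₁)Q(b₂−b₀)]`, `Q(x) = sin(πx)/x` —
the bracket is exactly the quantity of `Det.gramSign_pos` (p481730).
[cite: Zhang2022LandauSiegel, §8 (8.11)–(8.23); proof of Prop 7.1 (7.19)–(7.21)] -/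
theorem detGramClosed_eq_sinc_form {b : Fin 3 → ℝ} (h0 : b 0 ≠ 0) (h1 : b 1 ≠ 0) (h2 : b 2 ≠ 0) (h01 : b 0 ≠ b 1)
    (h02 : b 0 ≠ b 2) (h12 : b 1 ≠ b 2) :
    detGramClosed b =
      16 / b 2 * c0Closed b ^ 2 * ((b 1 - b 0) * (b 2 - b 0) ^ 2 * (b 2 - b 1) ^ 2) *
        (Real.sin (π * b 0) / b 0 * (Real.sin (π * (b 2 - b 1)) / (b 2 - b 1))
          - Real.sin (π * b 1) / b 1 * (Real.sin (π * (b 2 - b 0)) / (b 2 - b 0))) := by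
  have d10 : b 1 - b 0 ≠ 0 := sub_ne_zero.2 (Ne.symm h01)
  have d21 : b 2 - b 1 ≠ 0 := sub_ne_zero.2 (Ne.symm h12)
  have d20 : b 2 - b 0 ≠ 0 := sub_ne_zero.2 (Ne.symm h02)
  have hD : dPlus b ≠ 0 := by unfold dPlus; exact mul_ne_zero (mul_ne_zero d10 d20) d21
  have hΦ1 : phiTheta 1 b =
      b 0 * b 1 * (b 2 - b 1) * (b 2 - b 0) *
        (Real.sin (π * b 0) / b 0 * (Real.sin (π * (b 2 - b 1)) / (b 2 - b 1))
          - Real.sin (π * b 1) / b 1 * (Real.sin (π * (b 2 - b 0)) / (b 2 - b 0))) := by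
    unfold phiTheta
    simp only [one_mul]
    field_simp
  unfold detGramClosed c0Closed
  rw [hΦ1]
  unfold dPlus
  field_simp
  ring

/-- **DOUBLING form of the predicted determinant** (memo §9 (1)):
`detGramClosed b = 16·c₀(b)²·c₀(2b)·D⁺(b)²/(b₀b₁b₂)` — the sign of the determinant is the sign of the leading
coefficient at the doubled triple `2b`. [cite: Zhang2022LandauSiegel, §8 (8.11)–(8.23); proof of Prop 7.1 (7.19)–(7.21)] -/
theorem detGramClosed_eq_doubling {b : Fin 3 → ℝ} (h01 : b 0 ≠ b 1) (h02 : b 0 ≠ b 2) (h12 : b 1 ≠ b 2) :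
    detGramClosed b =
      16 * c0Closed b ^ 2 * c0Closed (fun j => 2 * b j) * dPlus b ^ 2 / (b 0 * b 1 * b 2) := by
  have d10 : b 1 - b 0 ≠ 0 := sub_ne_zero.2 (Ne.symm h01)
  have d21 : b 2 - b 1 ≠ 0 := sub_ne_zero.2 (Ne.symm h12)
  have d20 : b 2 - b 0 ≠ 0 := sub_ne_zero.2 (Ne.symm h02)
  have hD : dPlus b ≠ 0 := by unfold dPlus; exact mul_ne_zero (mul_ne_zero d10 d20) d21
  unfold detGramClosed c0Closed
  rw [dPlus_double, phiTheta_one_eq_phiHalf_double]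
  by_cases hb : b 0 * b 1 * b 2 = 0
  · rw [hb]; simp
  · field_simp
    ring

/-! ### Part 4 — SIGNS on the sign-admissible set -/

/-- **`detGramClosed b > 0` for every sign-admissible `b` of gap `k` OFF the three edges through the lattice corner**
(`{b₁ = k, b₂ = k+1}`, `{b₀ = 1, b₁ = k}`, `{b₀ = 1, b₂ = k+1}`): (I1) `c₀ > 0` (`Det.re_sum_shiftW_pos`) and (I2)
`Q(b₀)Q(b₂−b₁) − Q(b₁)Q(b₂−b₀) > 0` (`Det.gramSign_pos`) in the `sinc` form. With Id-2 (E-CERT-005) this is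
«`det C(b) > 0` off the edges», the non-degeneracy input of the index argument (H-CLOSED-FORM §3).
[cite: Zhang2022LandauSiegel, §2 Lemma 2.3; §8 (8.11)–(8.23)] -/
theorem detGramClosed_pos {b : Fin 3 → ℝ} {k : ℕ} (h0 : 0 < b 0) (h01 : b 0 < b 1) (h12 : b 1 < b 2)
    (h1 : b 0 ≤ 1) (hk1 : (k : ℝ) ≤ b 1) (hk2 : b 2 ≤ k + 1)
    (he1 : ¬ (b 1 = k ∧ b 2 = k + 1)) (he2 : ¬ (b 0 = 1 ∧ b 1 = k)) (he3 : ¬ (b 0 = 1 ∧ b 2 = k + 1)) :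
    0 < detGramClosed b := by
  have h02 : b 0 < b 2 := h01.trans h12
  have hb1 : 0 < b 1 := h0.trans h01
  have hb2 : 0 < b 2 := hb1.trans h12
  have hadm : SignAdmissible b := ⟨h0, h01, h12, h1, k, hk1, hk2⟩
  rw [detGramClosed_eq_sinc_form h0.ne' hb1.ne' hb2.ne' h01.ne h02.ne h12.ne]
  have hc := c0Closed_pos hadm
  have hg := gramSign_pos h0 h01 h12 h1 hk1 hk2 he1 he2 he3
  have hpre : 0 < 16 / b 2 * c0Closed b ^ 2 * ((b 1 - b 0) * (b 2 - b 0) ^ 2 * (b 2 - b 1) ^ 2) := by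
    have := sub_pos.2 h01; have := sub_pos.2 h02; have := sub_pos.2 h12
    positivity
  exact mul_pos hpre hg

/-- **`detGramClosed b ≥ 0` on the CLOSED gap cell** (edges included; `Det.gramSign_nonneg`).
[cite: Zhang2022LandauSiegel, §2 Lemma 2.3; §8 (8.11)–(8.23)] -/
theorem detGramClosed_nonneg {b : Fin 3 → ℝ} {k : ℕ} (h0 : 0 < b 0) (h01 : b 0 < b 1) (h12 : b 1 < b 2)
    (h1 : b 0 ≤ 1) (hk1 : (k : ℝ) ≤ b 1) (hk2 : b 2 ≤ k + 1) : 0 ≤ detGramClosed b := by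
  have h02 : b 0 < b 2 := h01.trans h12
  have hb1 : 0 < b 1 := h0.trans h01
  have hb2 : 0 < b 2 := hb1.trans h12
  rw [detGramClosed_eq_sinc_form h0.ne' hb1.ne' hb2.ne' h01.ne h02.ne h12.ne]
  have hg := gramSign_nonneg h0 h01 h12 h1 hk1 hk2
  have hpre : 0 ≤ 16 / b 2 * c0Closed b ^ 2 * ((b 1 - b 0) * (b 2 - b 0) ^ 2 * (b 2 - b 1) ^ 2) := by
    have := sub_pos.2 h01; have := sub_pos.2 h02; have := sub_pos.2 h12
    positivity
  exact mul_nonneg hpre hg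

/-- The same sign statements for a `SignAdmissible` triple with its gap made explicit: `detGramClosed b ≥ 0`.
[cite: Zhang2022LandauSiegel, §2 Lemma 2.3; §8 (8.11)–(8.23)] -/
theorem detGramClosed_nonneg_of_signAdmissible {b : Fin 3 → ℝ} (hb : SignAdmissible b) : 0 ≤ detGramClosed b := by
  obtain ⟨h0, h01, h12, h1, k, hk1, hk2⟩ := hb
  exact detGramClosed_nonneg h0 h01 h12 h1 hk1 hk2

/-! ### Part 5 — controls: the printed detector `(1,2,3)` and the anchor `b⋆ = (½, 2, 5/2)` -/

/-- `Φ_{1/2}(1,2,3) = 4` (all three half-angle sines are `±1`, `sin(π/2) = 1`, `sin π = 0`).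
[cite: Zhang2022LandauSiegel, proof of Prop 7.1 (7.19)–(7.21)] -/
theorem phiHalf_std : phiTheta (1 / 2) ![1, 2, 3] = 4 := by
  unfold phiTheta
  simp only [Matrix.cons_val_zero, Matrix.cons_val_one, Matrix.head_cons, Matrix.cons_val_two, Matrix.tail_cons]
  have e1 : 1 / 2 * π * (1:ℝ) = π / 2 := by ring
  have e2 : 1 / 2 * π * ((3:ℝ) - 2) = π / 2 := by ring
  have e3 : 1 / 2 * π * (2:ℝ) = π := by ring
  rw [e1, e2, e3, Real.sin_pi_div_two, Real.sin_pi]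
  ring

/-- `c₀(1,2,3) = 4` (the tree's `re_sum_shiftW_std`; `D⁺(1,2,3) = 2`). [cite: Zhang2022LandauSiegel, proof of Prop 7.1 (7.19)–(7.21)] -/
theorem c0Closed_std : c0Closed ![1, 2, 3] = 4 := by
  unfold c0Closed
  rw [phiHalf_std]
  unfold dPlus
  simp only [Matrix.cons_val_zero, Matrix.cons_val_one, Matrix.head_cons, Matrix.cons_val_two, Matrix.tail_cons]
  norm_num

/-- `Φ₁(1,2,3) = 0` (`sin π = sin 2π = 0`): the predicted determinant VANISHES at the printed detector — `C(1,2,3) = 0`,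
the tree's one-sided kernel (`Det.gramSign_std`). [cite: Zhang2022LandauSiegel, Prop 7.1 p.44] -/
theorem phiOne_std : phiTheta 1 ![1, 2, 3] = 0 := by
  unfold phiTheta
  simp only [Matrix.cons_val_zero, Matrix.cons_val_one, Matrix.head_cons, Matrix.cons_val_two, Matrix.tail_cons]
  have e1 : (1:ℝ) * π * 1 = π := by ring
  have e2 : (1:ℝ) * π * 2 = (2:ℕ) * π := by push_cast; ring
  rw [e1, e2, Real.sin_pi, Real.sin_nat_mul_pi]
  ring

/-- `detGramClosed (1,2,3) = 0`. [cite: Zhang2022LandauSiegel, Prop 7.1 p.44] -/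
theorem detGramClosed_std : detGramClosed ![1, 2, 3] = 0 := by
  unfold detGramClosed; rw [phiOne_std]; simp

/-- The anchor of record `b⋆ = (½, 2, 5/2)` (p473995). [cite: Zhang2022LandauSiegel, §2 (2.13)] -/
def bStarTriple : Fin 3 → ℝ := ![1 / 2, 2, 5 / 2]

/-- `Φ_{1/2}(b⋆) = 2` (`sin(π/4)² = 1/2`, `sin π = 0`). [cite: Zhang2022LandauSiegel, proof of Prop 7.1 (7.19)–(7.21)] -/
theorem phiHalf_bStar : phiTheta (1 / 2) bStarTriple = 2 := by
  unfold phiTheta bStarTriple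
  simp only [Matrix.cons_val_zero, Matrix.cons_val_one, Matrix.head_cons, Matrix.cons_val_two, Matrix.tail_cons]
  have e1 : 1 / 2 * π * (1 / 2 : ℝ) = π / 4 := by ring
  have e2 : 1 / 2 * π * ((5:ℝ) / 2 - 2) = π / 4 := by ring
  have e3 : 1 / 2 * π * (2:ℝ) = π := by ring
  rw [e1, e2, e3, Real.sin_pi_div_four, Real.sin_pi]
  have h2 : Real.sqrt 2 * Real.sqrt 2 = 2 := Real.mul_self_sqrt (by norm_num)
  nlinarith [h2]

/-- `Φ₁(b⋆) = 4` (`sin(π/2) = 1`, `sin 2π = 0`). [cite: Zhang2022LandauSiegel, proof of Prop 7.1 (7.19)–(7.21)] -/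
theorem phiOne_bStar : phiTheta 1 bStarTriple = 4 := by
  unfold phiTheta bStarTriple
  simp only [Matrix.cons_val_zero, Matrix.cons_val_one, Matrix.head_cons, Matrix.cons_val_two, Matrix.tail_cons]
  have e1 : (1:ℝ) * π * (1 / 2) = π / 2 := by ring
  have e2 : (1:ℝ) * π * (5 / 2 - 2) = π / 2 := by ring
  have e3 : (1:ℝ) * π * 2 = (2:ℕ) * π := by push_cast; ring
  rw [e1, e2, e3, Real.sin_pi_div_two, Real.sin_nat_mul_pi]
  norm_num

/-- `c₀(b⋆) = 8/3` (= p473995's pivot `8/3`; `D⁺(b⋆) = 3/2`). [cite: Zhang2022LandauSiegel, proof of Prop 7.1 (7.19)–(7.21)] -/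
theorem c0Closed_bStar : c0Closed bStarTriple = 8 / 3 := by
  unfold c0Closed
  rw [phiHalf_bStar]
  unfold dPlus bStarTriple
  simp only [Matrix.cons_val_zero, Matrix.cons_val_one, Matrix.head_cons, Matrix.cons_val_two, Matrix.tail_cons]
  norm_num

/-- `detGramClosed(b⋆) = 4096/15` — the memo's control value `det C(b⋆) = 4096/15`
(`C(b⋆) = [[1024/15, −64i/15],[64i/15, 64/15]]`). [cite: Zhang2022LandauSiegel, §8 (8.11)–(8.23)] -/
theorem detGramClosed_bStar : detGramClosed bStarTriple = 4096 / 15 := by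
  unfold detGramClosed
  rw [phiHalf_bStar, phiOne_bStar]
  unfold dPlus bStarTriple
  simp only [Matrix.cons_val_zero, Matrix.cons_val_one, Matrix.head_cons, Matrix.cons_val_two, Matrix.tail_cons]
  norm_num

/-! ### Part 6 (v2) — [K1] vocabulary of the DOUBLING route: the bulk form `T_b` on an interval, the tail
primitive, the three atoms and Zhang's free-end boundary form (statement shapes of ls-barrier-num's
ShadowKernelSketch 1268210b689bb6c5, landed here so that K2/K3/K6 import ONE definition each) -/

/-- **The bulk form `T_b` on `[a, c]`** in the tail-primitive variable (`S′`, `S″` supplied as data):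
`∫_a^c (|S″|² + πe₁·Im(S″·conj S′) + π²e₂·|S′|² + π³e₃·Im(S′·conj S))`, `e_i` the elementary symmetric functions of
`b` (SHIFT-PSD §0.2; frequency symbol `π⁴·p_b`). [cite: Zhang2022LandauSiegel, Prop 7.1 p.44 with (8.11)–(8.23)] -/
def bulkFormOn (b : Fin 3 → ℝ) (a c : ℝ) (S S' S'' : ℝ → ℂ) : ℝ :=
  ∫ y in a..c, (‖S'' y‖ ^ 2 + π * (b 0 + b 1 + b 2) * (S'' y * (starRingEnd ℂ) (S' y)).im
    + π ^ 2 * (b 0 * b 1 + b 1 * b 2 + b 2 * b 0) * ‖S' y‖ ^ 2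
    + π ^ 3 * (b 0 * b 1 * b 2) * (S' y * (starRingEnd ℂ) (S y)).im)

/-- **The tail primitive** `S_g(y) = ∫_y^1 g`. [cite: Zhang2022LandauSiegel, Prop 7.1 p.44 with (8.11)–(8.12)] -/
def tailPrim (g : ℝ → ℂ) (y : ℝ) : ℂ := ∫ t in y..(1:ℝ), g t

/-- The atom `A₀(b) = Σ_j W_j(b)` (= `m₀`; for a distinct triple `= Det.ddM0 b`, `atomA0_eq_ddM0`).
[cite: Zhang2022LandauSiegel, proof of Prop 7.1 (7.19)–(7.21)] -/
def atomA0 (b : Fin 3 → ℝ) : ℂ := ∑ j : Fin 3, shiftW b j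

/-- The atom `A_b(b) = Σ_j W_j(b)·b_j` (= `m_b`; `atomAb_eq_ddMb`). [cite: Zhang2022LandauSiegel, §8 (8.13)–(8.18)] -/
def atomAb (b : Fin 3 → ℝ) : ℂ := ∑ j : Fin 3, shiftW b j * (b j : ℂ)

/-- The atom `A_N(b) = Σ_j W_j(b)·N_j(b)` (= `m_n`; `atomAN_eq_ddMn`). [cite: Zhang2022LandauSiegel, §8 (8.13)–(8.18)] -/
def atomAN (b : Fin 3 → ℝ) : ℂ := ∑ j : Fin 3, shiftW b j * (shiftN b j : ℂ)

/-- **Zhang's free-end boundary form at `y = 0`** in the coordinates `x = (S(0), S′(0))` (SHIFT-PSD §0.2 `x₀*·Bdm(b)·x₀`):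
`−(ImA₀/2)(π³e₃|x₁|² + πe₁|x₂|²) + π·ImA_b·|x₂|² + π²·Re(A_N·x₂·conj x₁)`.
[cite: Zhang2022LandauSiegel, Prop 7.1 p.44 with (8.11)–(8.23)] -/
def freeEndForm (b : Fin 3 → ℝ) (x₁ x₂ : ℂ) : ℝ :=
  -((atomA0 b).im / 2) * (π ^ 3 * (b 0 * b 1 * b 2) * ‖x₁‖ ^ 2 + π * (b 0 + b 1 + b 2) * ‖x₂‖ ^ 2)
    + π * (atomAb b).im * ‖x₂‖ ^ 2 + π ^ 2 * (atomAN b * x₂ * (starRingEnd ℂ) x₁).re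

/-- For a distinct triple `A₀ = ddM0` (the divided-difference moment of `DetectorShiftMomentsDD`).
[cite: Zhang2022LandauSiegel, proof of Prop 7.1 (7.19)–(7.21)] -/
theorem atomA0_eq_ddM0 {b : Fin 3 → ℝ} (hb : Function.Injective b) : atomA0 b = ddM0 b :=
  sum_shiftW_eq_ddM0 hb

/-- For a distinct triple `A_b = ddMb`. [cite: Zhang2022LandauSiegel, §8 (8.13)–(8.18)] -/
theorem atomAb_eq_ddMb {b : Fin 3 → ℝ} (hb : Function.Injective b) : atomAb b = ddMb b :=
  sum_shiftW_b_eq_ddMb hb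

/-- For a distinct triple `A_N = ddMn`. [cite: Zhang2022LandauSiegel, §8 (8.13)–(8.18)] -/
theorem atomAN_eq_ddMn {b : Fin 3 → ℝ} (hb : Function.Injective b) : atomAN b = ddMn b :=
  sum_shiftW_n_eq_ddMn hb

/-- `c₀(b) = Re A₀(b)` is the closed form `c0Closed b` (distinct triple). [cite: Zhang2022LandauSiegel, proof of Prop 7.1 (7.19)–(7.21)] -/
theorem atomA0_re_eq_c0Closed (b : Fin 3 → ℝ) (h01 : b 0 ≠ b 1) (h02 : b 0 ≠ b 2) (h12 : b 1 ≠ b 2) :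
    (atomA0 b).re = c0Closed b :=
  re_sum_shiftW_eq_c0Closed b h01 h02 h12

/-- `S_g(1) = 0`. [cite: Zhang2022LandauSiegel, Prop 7.1 p.44 with (8.11)–(8.12)] -/
theorem tailPrim_one (g : ℝ → ℂ) : tailPrim g 1 = 0 := by simp [tailPrim]

/-- `S_g(0) = ∫₀¹ g`. [cite: Zhang2022LandauSiegel, Prop 7.1 p.44 with (8.11)–(8.12)] -/
theorem tailPrim_zero (g : ℝ → ℂ) : tailPrim g 0 = ∫ t in (0:ℝ)..1, g t := rfl

/-- `S_g(y) = ∫₀¹ g − ∫₀^y g` on `[0,1]` (for `g` integrable on `[0,1]`). [cite: Zhang2022LandauSiegel, Prop 7.1 p.44 with (8.11)–(8.12)] -/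
theorem tailPrim_eq_sub {g : ℝ → ℂ} (hg : IntervalIntegrable g MeasureTheory.volume 0 1) {y : ℝ}
    (hy : y ∈ Set.Icc (0:ℝ) 1) :
    tailPrim g y = (∫ t in (0:ℝ)..1, g t) - ∫ t in (0:ℝ)..y, g t := by
  unfold tailPrim
  have h0y : IntervalIntegrable g MeasureTheory.volume 0 y := intervalIntegrable_mono_unit hg hy
  have hy1 : IntervalIntegrable g MeasureTheory.volume y 1 :=
    hg.mono_set (by
      rw [Set.uIcc_of_le hy.2, Set.uIcc_of_le zero_le_one]
      exact Set.Icc_subset_Icc_left hy.1)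
  rw [← intervalIntegral.integral_add_adjacent_intervals h0y hy1]
  ring

/-! ### Part 7 (v2) — [K1] THE S-VARIABLE CLOSED FORM `(π/2)·𝔅_{R(b)}(g) = Re A₀·T_b^{[0,1]}(S_g) + freeEndForm(S_g(0), S_g′(0))` -/

section K1

open MeasureTheory intervalIntegral ComplexConjugate Set Repair

variable {b : Fin 3 → ℝ} {g g' : ℝ → ℂ}

/-- Real part of an integrable function commutes with `∫₀¹`. [folklore] -/
private theorem integral_re_unit {f : ℝ → ℂ} (hf : IntervalIntegrable f volume 0 1) :
    ∫ x in (0:ℝ)..1, (f x).re = (∫ x in (0:ℝ)..1, f x).re := by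
  have h := Complex.reCLM.intervalIntegral_comp_comm hf
  simpa only [Complex.reCLM_apply] using h

/-- Imaginary part of an integrable function commutes with `∫₀¹`. [folklore] -/
private theorem integral_im_unit {f : ℝ → ℂ} (hf : IntervalIntegrable f volume 0 1) :
    ∫ x in (0:ℝ)..1, (f x).im = (∫ x in (0:ℝ)..1, f x).im := by
  have h := Complex.imCLM.intervalIntegral_comp_comm hf
  simpa only [Complex.imCLM_apply] using h

/-- Real part of an integrable function is integrable on `[0,1]`. [folklore] -/
private theorem intervalIntegrable_re_unit {f : ℝ → ℂ} (hf : IntervalIntegrable f volume 0 1) :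
    IntervalIntegrable (fun x => (f x).re) volume 0 1 := by
  rw [intervalIntegrable_iff] at hf ⊢
  exact hf.re

/-- Imaginary part of an integrable function is integrable on `[0,1]`. [folklore] -/
private theorem intervalIntegrable_im_unit {f : ℝ → ℂ} (hf : IntervalIntegrable f volume 0 1) :
    IntervalIntegrable (fun x => (f x).im) volume 0 1 := by
  rw [intervalIntegrable_iff] at hf ⊢
  exact hf.im

/-- **The `S ↔ g` dictionary: `T_b^{[0,1]}(S_g) = Re Q_b(g,g)`** for an `H¹`-type (kinked) profile — with `S = S_g`,
`S′ = −g`, `S″ = −g′` supplied as data, the bulk form `bulkFormOn b 0 1` is the real part of the collapsed core form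
`Det.shiftCore` (`re_shiftCore_self`, p482386): `|S″|² = |g′|²`, `Im(S″·conj S′) = −Im(g·conj g′)`, `|S′|² = |g|²`,
`Im(S′·conj S) = Im(g·conj ∫₀^y g)` up to the real constant `|∫g|²`. [cite: Zhang2022LandauSiegel, Prop 7.1 p.44 with (8.11)–(8.23)] -/
theorem bulkFormOn_tailPrim_eq_re_shiftCore (b : Fin 3 → ℝ) (hg : KinkedProfile g g') :
    bulkFormOn b 0 1 (tailPrim g) (fun y => -g y) (fun y => -g' y)
      = (shiftCore (symE1 b) (symE2 b) (symE3 b) g g' g g').re := by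
  have hH := hg.isH1
  -- integrability of the four pairings
  have hgi : IntervalIntegrable g volume 0 1 := hg.cont.intervalIntegrable_of_Icc zero_le_one
  have hdd := IsH1OnUnitInterval.intervalIntegrable_deriv_mul_conj_deriv hH hH
  have hdg := IsH1OnUnitInterval.intervalIntegrable_deriv_mul_conj hH hH
  have hgg := IsH1OnUnitInterval.intervalIntegrable_mul_conj hH hH
  have hgP := IsH1OnUnitInterval.intervalIntegrable_mul_conj_primitive hH hH
  have hgI : IntervalIntegrable (fun y => g y * conj (∫ t in (0:ℝ)..1, g t)) volume 0 1 := hgi.mul_const _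
  -- the integrand, rewritten pointwise on `[0,1]`
  set e1 := b 0 + b 1 + b 2 with he1
  set e2 := b 0 * b 1 + b 1 * b 2 + b 2 * b 0 with he2
  set e3 := b 0 * b 1 * b 2 with he3
  have hpt : ∀ y ∈ uIcc (0:ℝ) 1,
      (‖-g' y‖ ^ 2 + π * e1 * ((-g' y) * conj (-g y)).im + π ^ 2 * e2 * ‖-g y‖ ^ 2
        + π ^ 3 * e3 * ((-g y) * conj (tailPrim g y)).im)
      = (g' y * conj (g' y)).re + π * e1 * (g' y * conj (g y)).im + π ^ 2 * e2 * (g y * conj (g y)).re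
        + (-(π ^ 3 * e3)) * (g y * conj (∫ t in (0:ℝ)..1, g t)).im
        + π ^ 3 * e3 * (g y * conj (∫ t in (0:ℝ)..y, g t)).im := by
    intro y hy
    rw [uIcc_of_le zero_le_one] at hy
    rw [tailPrim_eq_sub hgi hy]
    have h1 : ‖-g' y‖ ^ 2 = (g' y * conj (g' y)).re := by
      rw [norm_neg, Complex.mul_conj', ← Complex.ofReal_pow, Complex.ofReal_re]
    have h2 : ‖-g y‖ ^ 2 = (g y * conj (g y)).re := by
      rw [norm_neg, Complex.mul_conj', ← Complex.ofReal_pow, Complex.ofReal_re]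
    rw [h1, h2, map_sub, map_neg]
    simp only [neg_mul, mul_neg, neg_neg, Complex.neg_im, mul_sub, Complex.sub_im]
    ring
  unfold bulkFormOn
  rw [intervalIntegral.integral_congr hpt]
  -- split the integral
  have i1 := intervalIntegrable_re_unit hdd
  have i2 := (intervalIntegrable_im_unit hdg).const_mul (π * e1)
  have i3 := (intervalIntegrable_re_unit hgg).const_mul (π ^ 2 * e2)
  have i4 := (intervalIntegrable_im_unit hgI).const_mul (-(π ^ 3 * e3))
  have i5 := (intervalIntegrable_im_unit hgP).const_mul (π ^ 3 * e3)
  rw [intervalIntegral.integral_add (((i1.add i2).add i3).add i4) i5,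
    intervalIntegral.integral_add ((i1.add i2).add i3) i4,
    intervalIntegral.integral_add (i1.add i2) i3, intervalIntegral.integral_add i1 i2,
    intervalIntegral.integral_const_mul, intervalIntegral.integral_const_mul,
    intervalIntegral.integral_const_mul, intervalIntegral.integral_const_mul,
    integral_re_unit hdd, integral_im_unit hdg, integral_re_unit hgg, integral_im_unit hgI, integral_im_unit hgP]
  -- the `∫ g·conj I₀ = I₀·conj I₀` term is real
  have hII : (∫ y in (0:ℝ)..1, g y * conj (∫ t in (0:ℝ)..1, g t)).im = 0 := by
    rw [intervalIntegral.integral_mul_const, Complex.mul_conj', ← Complex.ofReal_pow, Complex.ofReal_im]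
  have hII' : ((∫ t in (0:ℝ)..1, g t) * conj (∫ t in (0:ℝ)..1, g t)).im = 0 := by
    rw [Complex.mul_conj', ← Complex.ofReal_pow, Complex.ofReal_im]
  -- `Im⟨g′,g⟩ = −Im⟨g,g′⟩`
  have hswap : (∫ y in (0:ℝ)..1, g' y * conj (g y)).im = -(∫ y in (0:ℝ)..1, g y * conj (g' y)).im := by
    have : (∫ y in (0:ℝ)..1, g' y * conj (g y)) = conj (∫ y in (0:ℝ)..1, g y * conj (g' y)) := by
      rw [← intervalIntegral_conj]; congr 1; funext x; simp [mul_comm]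
    rw [this, Complex.conj_im]
  rw [re_shiftCore_self, hII, hswap, Complex.sub_im, hII']
  simp only [symE1, symE2, symE3, he1, he2, he3]
  ring

/-- **The free-end form IS the boundary block of `formDetDD_eq_reIm`** (distinct triple; `Im m_s = e₁·Im A₀ − Im A_b`):
`freeEndForm b I₀ (−z) = −Im m₀·(−(πe₁/2)|z|² + (π³e₃/2)|I₀|²) − π·Im m_s·|z|² − π²·Re(m_n·z·conj I₀)`.
[cite: Zhang2022LandauSiegel, Prop 7.1 p.44 with (8.11)–(8.23)] -/
theorem freeEndForm_eq_boundary (hb : Function.Injective b) (I₀ z : ℂ) :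
    freeEndForm b I₀ (-z)
      = -(ddM0 b).im * (-(π * symE1 b / 2) * ‖z‖ ^ 2 + π ^ 3 * symE3 b / 2 * ‖I₀‖ ^ 2)
        - π * (ddMs b).im * ‖z‖ ^ 2 - π ^ 2 * (ddMn b * (z * conj I₀)).re := by
  unfold freeEndForm symE1 symE3
  rw [atomA0_eq_ddM0 hb, atomAb_eq_ddMb hb, atomAN_eq_ddMn hb]
  have hMs : (ddMs b).im = (b 0 + b 1 + b 2) * (ddM0 b).im - (ddMb b).im := by
    have h2 : (2 : ℂ) * (shiftB b : ℂ) = ((b 0 + b 1 + b 2 : ℝ) : ℂ) := by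
      rw [← symE1, ← two_mul_shiftB]; push_cast; ring
    rw [ddMs, h2, Complex.sub_im, Complex.im_ofReal_mul]
  have hcross : (ddMn b * -z * (starRingEnd ℂ) I₀).re = -(ddMn b * (z * conj I₀)).re := by
    rw [show ddMn b * -z * (starRingEnd ℂ) I₀ = -(ddMn b * (z * conj I₀)) by ring, Complex.neg_re]
  rw [norm_neg, hMs, hcross]
  ring

/-- **[K1] THE S-VARIABLE CLOSED FORM (DOUBLING plan of record, piece K1):** for a DISTINCT real shift triple `b` and
a one-sided kinked profile `g` (`g(1) = 0`), with the tail primitive `S_g = ∫_y^1 g` (`S_g′ = −g`, `S_g″ = −g′`,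
`S_g(0) = ∫₀¹ g`, `S_g′(0) = −g(0)`):
`(π/2)·FormDet(shiftRecipe b)(g) = Re A₀(b)·T_b^{[0,1]}(S_g) + freeEndForm b (S_g(0)) (S_g′(0))` — exactly the `K1Shape b
(freeEndForm b)` of the K6 composition sketch. [cite: Zhang2022LandauSiegel, Prop 7.1 p.44 with (8.11)–(8.23)] -/
theorem formDet_shiftRecipe_eq_bulk_add_freeEnd (hb : Function.Injective b) (hg : KinkedProfile g g')
    (hg1 : g 1 = 0) :
    π / 2 * FormDet (shiftRecipe b) g g'
      = (∑ j : Fin 3, shiftW b j).re * bulkFormOn b 0 1 (tailPrim g) (fun y => -g y) (fun y => -g' y)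
        + freeEndForm b (∫ y in (0:ℝ)..1, g y) (-g 0) := by
  rw [← formDetDD_eq_formDet hb hg hg1, formDetDD_eq_reIm b hg hg1, bulkFormOn_tailPrim_eq_re_shiftCore b hg,
    freeEndForm_eq_boundary hb, ← atomA0_eq_ddM0 hb]
  unfold atomA0
  have hπ : (π : ℝ) ≠ 0 := Real.pi_ne_zero
  have hcross : (ddMn b * (g 0 * conj (∫ x in (0:ℝ)..1, g x))).re
      = (ddMn b * (g 0 * conj (∫ y in (0:ℝ)..1, g y))).re := rfl
  field_simp
  ring

/-- The same closed form for every SIGN-ADMISSIBLE triple (distinctness is automatic).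
[cite: Zhang2022LandauSiegel, §2 Lemma 2.3; Prop 7.1 p.44 with (8.11)–(8.23)] -/
theorem formDet_shiftRecipe_eq_bulk_add_freeEnd_of_signAdmissible (hb : SignAdmissible b) (hg : KinkedProfile g g')
    (hg1 : g 1 = 0) :
    π / 2 * FormDet (shiftRecipe b) g g'
      = (∑ j : Fin 3, shiftW b j).re * bulkFormOn b 0 1 (tailPrim g) (fun y => -g y) (fun y => -g' y)
        + freeEndForm b (∫ y in (0:ℝ)..1, g y) (-g 0) :=
  formDet_shiftRecipe_eq_bulk_add_freeEnd hb.injective hg hg1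

/-- **Dictionary of conventions (reader's ask): `m_s = e₁·A₀ − A_b`** — the tree's moment `ddMs b` (`= Σ_j W_j s_j`
for a distinct triple) versus the atoms `A₀ = Σ_j W_j`, `A_b = Σ_j W_j b_j` of SHIFT-PSD §0.2 (`s_j = e₁ − b_j`).
[cite: Zhang2022LandauSiegel, §8 (8.13)–(8.18)] -/
theorem ddMs_eq_symE1_mul_atomA0_sub_atomAb (hb : Function.Injective b) :
    ddMs b = (symE1 b : ℂ) * atomA0 b - atomAb b := by
  rw [atomA0_eq_ddM0 hb, atomAb_eq_ddMb hb, ddMs, ← two_mul_shiftB]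
  push_cast
  ring

/-- … in imaginary parts: `Im m_s = e₁·Im A₀ − Im A_b`. [cite: Zhang2022LandauSiegel, §8 (8.13)–(8.18)] -/
theorem ddMs_im_eq (hb : Function.Injective b) :
    (ddMs b).im = symE1 b * (atomA0 b).im - (atomAb b).im := by
  rw [ddMs_eq_symE1_mul_atomA0_sub_atomAb hb, Complex.sub_im, Complex.im_ofReal_mul]

/-- **The free-end form as a Hermitian 2×2 form in g0's convention** `Q(x) = Re Σ_{a,c} x_a·conj(x_c)·B[a][c]` with
`B = [[−(ImA₀)π³e₃/2, π²·conj(A_N)/2], [π²·A_N/2, −(ImA₀)πe₁/2 + π·ImA_b]]` (barrier/num SHIFT-PSD §0.2 `Bdm(b)`; the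
derived closed form `H(b) = c₀Π_R + Bdm` of H-CLOSED-FORM §10 is NOT asserted here).
[cite: Zhang2022LandauSiegel, Prop 7.1 p.44 with (8.11)–(8.23)] -/
theorem freeEndForm_eq_bdm (b : Fin 3 → ℝ) (x₁ x₂ : ℂ) :
    freeEndForm b x₁ x₂
      = (x₁ * conj x₁ * (((-((atomA0 b).im) * π ^ 3 * (b 0 * b 1 * b 2) / 2 : ℝ) : ℂ))
          + x₁ * conj x₂ * ((π : ℂ) ^ 2 * conj (atomAN b) / 2)
          + x₂ * conj x₁ * ((π : ℂ) ^ 2 * atomAN b / 2)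
          + x₂ * conj x₂ * (((-((atomA0 b).im) * π * (b 0 + b 1 + b 2) / 2 + π * (atomAb b).im : ℝ) : ℂ))).re := by
  set r₁ : ℝ := -((atomA0 b).im) * π ^ 3 * (b 0 * b 1 * b 2) / 2 with hr₁
  set r₂ : ℝ := -((atomA0 b).im) * π * (b 0 + b 1 + b 2) / 2 + π * (atomAb b).im with hr₂
  set C : ℂ := x₂ * conj x₁ * ((π : ℂ) ^ 2 * atomAN b / 2) with hC
  have h1 : x₁ * conj x₁ = ((‖x₁‖ ^ 2 : ℝ) : ℂ) := by rw [Complex.mul_conj', Complex.ofReal_pow]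
  have h2 : x₂ * conj x₂ = ((‖x₂‖ ^ 2 : ℝ) : ℂ) := by rw [Complex.mul_conj', Complex.ofReal_pow]
  -- the two cross terms are complex conjugates of each other
  have hcc : x₁ * conj x₂ * ((π : ℂ) ^ 2 * conj (atomAN b) / 2) = conj C := by
    rw [hC]
    simp only [map_mul, map_div₀, map_pow, Complex.conj_conj, Complex.conj_ofReal, map_ofNat]
    ring
  rw [h1, h2, hcc]
  have key : (((‖x₁‖ ^ 2 : ℝ) : ℂ) * ((r₁ : ℝ) : ℂ) + conj C + C + ((‖x₂‖ ^ 2 : ℝ) : ℂ) * ((r₂ : ℝ) : ℂ)).re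
      = ‖x₁‖ ^ 2 * r₁ + 2 * C.re + ‖x₂‖ ^ 2 * r₂ := by
    simp only [Complex.add_re, Complex.conj_re, ← Complex.ofReal_mul, Complex.ofReal_re]
    ring
  rw [key]
  have hre : C.re = π ^ 2 * (atomAN b * x₂ * (starRingEnd ℂ) x₁).re / 2 := by
    have : C = ((π ^ 2 / 2 : ℝ) : ℂ) * (atomAN b * x₂ * conj x₁) := by
      rw [hC]; push_cast; ring
    rw [this, Complex.re_ofReal_mul]
    ring
  rw [hre, hr₁, hr₂]
  unfold freeEndForm
  ring

end K1

end Det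

end Literature.NumberTheory.LFunctions.Zhang2022
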